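import Literature.NumberTheory.Automorphic.ArchRankOneJumpAllOrdersChart          -- ★ FILE 4d (F0P3a-p09 (g6)): `exists_hasOneSidedJump_iteratedDeriv_allOrders_chart_of_eq_over`; brings ★ 4c, ★ FILE 4a (evenness), ★ (A0-b), the Iwasawa scalar
import Literature.NumberTheory.Automorphic.ArchRankOneOrbitalFamilyParamCayley      -- ★ p851143 (F0P3a-p04 (g24)): `contDiffOn_cayley_orbitalIntegral_param` (the elliptic reader is `C^∞` off the walls)
import HarnessLib

/-!
# THE ALL-ORDERS RANK-ONE JUMP RELATION FOR THE ODD-ISED (STABLE) ELLIPTIC FAMILY `ψ ↦ F_f(ψ) − F_f(−ψ)`: jump `2κ₀ · iⁿ · ∂ₓⁿ Λ_f(0)`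
# (Shelstad 1979 Lemma 4.3, Prop. 4.5, Thm. 4.7 (IIIb): the STABLE orbital integral `Ψ^{T,1} = Σ_w Φ^w` doubles the jump; Bouaziz 1994 §3.2 (I₃), §6.2; Varadarajan 1989 §6.4 Thm 24)

Topic `NumberTheory/Automorphic`; namespace `Literature.NumberTheory.Automorphic.UnitaryGroup`.  THEOREMS ONLY (no `def`, no instance, no notation, no axiom, no named fact, no `sorry`).
Cell `pub/hodgecm-mathlib`, crux H413 (`stmt-HodgeConjecture-24833`), line LH3 (closer stub `stub_N9`, direct road), letter L3′ forward half = the jump clause (J) of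
`ArchBouazizSpaceH jcH (stOrbFamH L νH fH)` for a GENERAL test function; brick **(JH-st-1)** of `F0/P3c/LH3/LH3-p01/g5/JH-SPEC.v2.md` (LH3-p01 (g5), JH binder of record).  Count-neutral.

WHY.  On the compact chart `S` (`w₀ ∉ S`) the stable family `stOrbFamH S` is the sum over the `2^{#compact places}` flips of the chart orbital functional (★ `exists_placeLeaves_stOrbFamH_model`
(c)); the flips containing `w₀` read the rank-one elliptic functional at `−ψ` (`t_1(−ψ)` is the OTHER element of the stable class of `t_1(ψ)` in `U(1,1)`, not conjugate to it), so along
the wall normal the `w₀`-factor of `e^{ρ}·Ψ_S` is the ODD-ISED reader `F_f(ψ) − F_f(−ψ)`.  Its jets jump by TWICE the jump of `F_f`: the even jets because `∂ⁿ[F_f ∘ neg] = (−1)ⁿ(∂ⁿF_f) ∘ neg`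
swaps the one-sided limits, the odd ones because both sides vanish — `∂ₓ^{odd} Λ_f(0) = 0`, `Λ_f` being (a multiple of) the EVEN normalised split orbital integral (★ FILE 4a).

WHAT IS PROVED.
* §1 `hasOneSidedJump_iteratedDeriv_sub_comp_neg` — GENERIC: `F : ℝ → ℂ` smooth on an open symmetric `T` containing a punctured neighbourhood of `0`, `HasOneSidedJump (∂ⁿF) J` and
  (`n` odd ⇒ `J = 0`) ⇒ `HasOneSidedJump (∂ⁿ(ψ ↦ F ψ − F(−ψ))) (2J)`.
* §2 **`exists_hasOneSidedJump_iteratedDeriv_allOrders_chart_stable_of_eq_over`** — ★ FILE 4d's head VERBATIM (same binders `hK hKB κ μN ΩJ hΩJ`, same reader tokens `hF`, `hΛ`, ONE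
  `κ₀ > 0` before `f`) with the conclusion `∀ n, HasOneSidedJump (fun ψ => iteratedDeriv n (fun ψ => F f ψ - F f (-ψ)) ψ) (((2 * κ₀ : ℝ) : ℂ) * I ^ n * iteratedDeriv n (Λ f) 0)`.
HONEST LABEL: HC_CM is proved only modulo the 7 printed citations (2 remaining: hLiu418 = `stmt-HodgeConjecture-24832`, h413 = `stmt-HodgeConjecture-24833`) until rung 0 closes; this
file re-reads ★ FILE 4d and pays nothing by itself.

## References
* [Shelstad1979] D. Shelstad, *Characters and inner forms of a quasi-split group over ℝ*, Compositio Math. 39 (1979), §4 (II) p. 23, Lemma 4.3 p. 25, Prop. 4.5 p. 26, Thm. 4.7 (IIIb) p. 31.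
* [Bouaziz1994IntegralesOrbitales] A. Bouaziz, *Intégrales orbitales sur les groupes de Lie réductifs*, Ann. Sci. ÉNS 27 (1994), §3.2 (I₃) p. 580, §6.2 p. 591.
* [Varadarajan1989] V. S. Varadarajan, *An Introduction to Harmonic Analysis on Semisimple Lie Groups*, Cambridge Stud. Adv. Math. 16 (1989), §6.4 Thms 23–24.
* [Rogawski1990] J. D. Rogawski, *Automorphic Representations of Unitary Groups in Three Variables*, Ann. of Math. Stud. 123 (1990), §8.2 pp. 119–123; §4.1 (4.1.1) p. 39.
-/

set_option autoImplicit false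

noncomputable section

open MeasureTheory Measure Set Filter Topology Complex NumberField NumberField.InfinitePlace
open scoped ENNReal NNReal ComplexConjugate ContDiff Matrix.Norms.Operator MatrixGroups Real

namespace Literature.NumberTheory.Automorphic

open Literature.MeasureTheory.Group Literature.NumberTheory.Automorphic.Shelstad1979.StableOrbitalIntegrals

namespace UnitaryGroup

open Literature.NumberTheory.Rogawski1990
open Literature.NumberTheory.Automorphic.UnitaryGroup.HeisRing Literature.NumberTheory.Automorphic.UnitaryGroup.LineRing

/-! ## §1 Generic: the odd-ised jets double the jump -/

/-- **ODD-ISATION DOUBLES THE JUMP.**  `T ⊆ ℝ` open, symmetric, containing a punctured neighbourhood of `0`; `F` smooth on `T`; if `∂ⁿF` has one-sided limits at `0` with jump `J`, and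
`J = 0` when `n` is odd, then `∂ⁿ(ψ ↦ F ψ − F(−ψ))` has one-sided limits at `0` with jump `2J` (`∂ⁿ[F ∘ neg](ψ) = (−1)ⁿ ∂ⁿF(−ψ)` swaps the two sides).
[cite: Shelstad1979, §4 (II) p. 23; Lemma 4.3 p. 25] [cite: Bouaziz1994IntegralesOrbitales, §6.2 p. 591] -/
theorem hasOneSidedJump_iteratedDeriv_sub_comp_neg {T : Set ℝ} (hT : IsOpen T) (hTsymm : ∀ ψ ∈ T, -ψ ∈ T) (hT0 : ∀ᶠ ψ in 𝓝[≠] (0 : ℝ), ψ ∈ T)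
    {F : ℝ → ℂ} (hF : ContDiffOn ℝ ∞ F T) {n : ℕ} {J : ℂ} (hJ : HasOneSidedJump (fun ψ => iteratedDeriv n F ψ) J) (hodd : Odd n → J = 0) :
    HasOneSidedJump (fun ψ => iteratedDeriv n (fun ψ => F ψ - F (-ψ)) ψ) (2 * J) := by
  obtain ⟨Lp, Lm, hp, hm, hJ'⟩ := hJ
  -- the odd-ised jet off the walls
  have heq : ∀ ψ ∈ T, iteratedDeriv n (fun ψ => F ψ - F (-ψ)) ψ = iteratedDeriv n F ψ - (-1 : ℝ) ^ n • iteratedDeriv n F (-ψ) := by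
    intro ψ hψ
    have h1 : ContDiffAt ℝ n F ψ := (hF.contDiffAt (hT.mem_nhds hψ)).of_le (by exact_mod_cast le_top)
    have h2 : ContDiffAt ℝ n (fun ψ => F (-ψ)) ψ :=
      ((hF.contDiffAt (hT.mem_nhds (hTsymm ψ hψ))).of_le (by exact_mod_cast le_top)).comp ψ contDiff_neg.contDiffAt
    rw [iteratedDeriv_fun_sub h1 h2, iteratedDeriv_comp_neg]
  have hGT : ∀ᶠ ψ in 𝓝[>] (0 : ℝ), iteratedDeriv n F ψ - (-1 : ℝ) ^ n • iteratedDeriv n F (-ψ) = iteratedDeriv n (fun ψ => F ψ - F (-ψ)) ψ :=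
    (hT0.filter_mono (nhdsWithin_mono _ fun x (hx : 0 < x) => ne_of_gt hx)).mono fun ψ hψ => (heq ψ hψ).symm
  have hLT : ∀ᶠ ψ in 𝓝[<] (0 : ℝ), iteratedDeriv n F ψ - (-1 : ℝ) ^ n • iteratedDeriv n F (-ψ) = iteratedDeriv n (fun ψ => F ψ - F (-ψ)) ψ :=
    (hT0.filter_mono (nhdsWithin_mono _ fun x (hx : x < 0) => ne_of_lt hx)).mono fun ψ hψ => (heq ψ hψ).symm
  -- `ψ ↦ ∂ⁿF(−ψ)` has the swapped one-sided limits
  have hnegGT : Tendsto (fun ψ : ℝ => -ψ) (𝓝[>] (0 : ℝ)) (𝓝[<] (0 : ℝ)) := by simpa using tendsto_neg_nhdsGT (a := (0 : ℝ))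
  have hnegLT : Tendsto (fun ψ : ℝ => -ψ) (𝓝[<] (0 : ℝ)) (𝓝[>] (0 : ℝ)) := by simpa using tendsto_neg_nhdsLT (a := (0 : ℝ))
  have hp' : Tendsto (fun ψ => iteratedDeriv n F (-ψ)) (𝓝[>] (0 : ℝ)) (𝓝 Lm) := hm.comp hnegGT
  have hm' : Tendsto (fun ψ => iteratedDeriv n F (-ψ)) (𝓝[<] (0 : ℝ)) (𝓝 Lp) := hp.comp hnegLT
  refine ⟨Lp - (-1 : ℝ) ^ n • Lm, Lm - (-1 : ℝ) ^ n • Lp, (hp.sub (hp'.const_smul _)).congr' hGT, (hm.sub (hm'.const_smul _)).congr' hLT, ?_⟩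
  rcases Nat.even_or_odd n with hn | hn
  · rw [hn.neg_one_pow, one_smul, one_smul, ← hJ']
    ring
  · rw [hodd hn] at hJ' ⊢
    rw [hn.neg_one_pow, neg_one_smul, neg_one_smul, sub_eq_zero.1 hJ']
    ring

/-! ## §2 The junction for the odd-ised family -/

variable (L : Type) [Field L] [NumberField L] (w : {w : InfinitePlace L // IsComplex w})
  {J : Matrix (Fin 2) (Fin 2) ℂ} (hJ : J = (StdForm.antidiagonal 2).over ℂ) [Fact (0 < 2 * π)]
  [MeasurableSpace ↥(unitaryGroupOfForm (starRingEnd ℂ) J)] [BorelSpace ↥(unitaryGroupOfForm (starRingEnd ℂ) J)]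
  (ν : Measure ↥(unitaryGroupOfForm (starRingEnd ℂ) J)) [ν.IsHaarMeasure] [ν.IsMulRightInvariant]
  {K : Subgroup ↥(unitaryGroupOfForm (starRingEnd ℂ) J)} (κ : Measure ↥K) (μN : Measure ↥(unipotentU (starRingEnd ℂ) J))

include L w hJ in
/-- **THE ALL-ORDERS RANK-ONE JUMP RELATION FOR THE ODD-ISED ELLIPTIC FAMILY, `K × N` CHART CURRENCY.**  Same binders and reader tokens as ★ FILE 4d
(`hK hKB κ μN ΩJ hΩJ`; `hF : F g ψ = (2 sin ψ : ℂ) * ∫_{U(J)} g ↑↑(h · P t_{e^{iθ}}(ψ) P⁻¹ · h⁻¹) dν`; `hΛ : Λ g x = ∫_{K×N} g ↑↑(k (t_{0,θ} h_{x∕2} n h_{x∕2}) k⁻¹) d(κ ⊗ μ_N)`), ONE `κ₀ > 0` BEFORE the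
test function, and for every `f ∈ C_c^∞`, `θ`, `n`: **`HasOneSidedJump (∂ⁿ(ψ ↦ F f ψ − F f (−ψ))) (2κ₀ · Iⁿ · ∂ⁿ(Λ f) 0)`** (★ 4d + §1; odd `n`: `∂ⁿ(Λ f)(0) = 0` by ★ FILE 4a through
★ (A0-b), `F f` is `C^∞` on `{sin ψ ≠ 0}` by ★ p851143). [cite: Shelstad1979, Prop. 4.5 p. 26; Thm. 4.7 (IIIb) p. 31] [cite: Bouaziz1994IntegralesOrbitales, §3.2 (I₃) p. 580; §6.2 p. 591]
[cite: Varadarajan1989, §6.4 Thm 24] -/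
theorem exists_hasOneSidedJump_iteratedDeriv_allOrders_chart_stable_of_eq_over
    (hK : IsCompact (K : Set ↥(unitaryGroupOfForm (starRingEnd ℂ) J))) (hKB : ∀ g : ↥(unitaryGroupOfForm (starRingEnd ℂ) J), ∃ k ∈ K, ∃ b ∈ borelU (starRingEnd ℂ) J, g = k * b)
    [IsHaarMeasure κ] [IsHaarMeasure μN] (ΩJ : (Matrix (Fin 2) (Fin 2) ℂ → ℂ) → Matrix (Fin 2) (Fin 2) ℂ → ℂ)
    (hΩJ : ∀ (g : Matrix (Fin 2) (Fin 2) ℂ → ℂ) (Y : Matrix (Fin 2) (Fin 2) ℂ), ΩJ g Y =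
      -(fderiv ℝ (fderiv ℝ g) Y (Y * !![0, I; I, 0]) (Y * !![0, I; I, 0]) + fderiv ℝ g Y (Y * !![0, I; I, 0] * !![0, I; I, 0])) +
        (fderiv ℝ (fderiv ℝ g) Y (Y * !![1, 0; 0, -1]) (Y * !![1, 0; 0, -1]) + fderiv ℝ g Y (Y * !![1, 0; 0, -1] * !![1, 0; 0, -1])) +
        (fderiv ℝ (fderiv ℝ g) Y (Y * !![0, I; -I, 0]) (Y * !![0, I; -I, 0]) + fderiv ℝ g Y (Y * !![0, I; -I, 0] * !![0, I; -I, 0]))) :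
    ∃ κ₀ : ℝ, 0 < κ₀ ∧ ∀ (f : Matrix (Fin 2) (Fin 2) ℂ → ℂ), ContDiff ℝ ∞ f → HasCompactSupport f → ∀ (θ : ℝ) (F : (Matrix (Fin 2) (Fin 2) ℂ → ℂ) → ℝ → ℂ),
      (∀ (g : Matrix (Fin 2) (Fin 2) ℂ → ℂ) (ψ : ℝ), F g ψ = (2 * Real.sin ψ : ℂ) *
        ∫ h : ↥(unitaryGroupOfForm (starRingEnd ℂ) J), g (((h * (⟨(Matrix.GeneralLinearGroup.mkOfDetNeZero !![(1 : ℂ), 1; 1, -1] det_cayleyTwo_ne_zero) * circleDiagonal 2 ![Circle.exp θ * Circle.exp ψ, Circle.exp θ * Circle.exp (-ψ)] * ((Matrix.GeneralLinearGroup.mkOfDetNeZero !![(1 : ℂ), 1; 1, -1] det_cayleyTwo_ne_zero))⁻¹,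
            cayley_conj_circleDiagonal_mem_of_eq_over hJ _⟩ : ↥(unitaryGroupOfForm (starRingEnd ℂ) J)) * h⁻¹ : ↥(unitaryGroupOfForm (starRingEnd ℂ) J)) : GL (Fin 2) ℂ) : Matrix (Fin 2) (Fin 2) ℂ) ∂ν) →
      ∀ (Λ : (Matrix (Fin 2) (Fin 2) ℂ → ℂ) → ℝ → ℂ), (∀ (g : Matrix (Fin 2) (Fin 2) ℂ → ℂ) (x : ℝ), Λ g x = ∫ p : ↥K × ↥(unipotentU (starRingEnd ℂ) J), g ((((((p.1 : ↥K) : ↥(unitaryGroupOfForm (starRingEnd ℂ) J)) * (((⟨hypBlockGL 0 θ, hypBlockGL_mem_of_eq_over hJ 0 θ⟩ : ↥(unitaryGroupOfForm (starRingEnd ℂ) J))) * ((⟨hypBlockGL (x / 2) 0, hypBlockGL_mem_of_eq_over hJ (x / 2) 0⟩ : ↥(unitaryGroupOfForm (starRingEnd ℂ) J))) * ((p.2 : ↥(unipotentU (starRingEnd ℂ) J)) : ↥(unitaryGroupOfForm (starRingEnd ℂ) J)) * ((⟨hypBlockGL (x / 2) 0, hypBlockGL_mem_of_eq_over hJ (x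 / 2) 0⟩ : ↥(unitaryGroupOfForm (starRingEnd ℂ) J)))) * ((p.1 : ↥K) : ↥(unitaryGroupOfForm (starRingEnd ℂ) J))⁻¹ : ↥(unitaryGroupOfForm (starRingEnd ℂ) J))) : GL (Fin 2) ℂ) : Matrix (Fin 2) (Fin 2) ℂ) ∂(κ.prod μN)) →
      ∀ n : ℕ, HasOneSidedJump (fun ψ : ℝ => iteratedDeriv n (fun ψ => F f ψ - F f (-ψ)) ψ) (((2 * κ₀ : ℝ) : ℂ) * Complex.I ^ n * iteratedDeriv n (Λ f) 0) := by
  haveI : LocallyCompactSpace ↥(unitaryGroupOfForm (starRingEnd ℂ) J) := locallyCompactSpace_unitaryGroupOfForm_complex J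
  haveI : SecondCountableTopology ↥(unitaryGroupOfForm (starRingEnd ℂ) J) := secondCountableTopology_unitaryGroupOfForm_complex J
  have hT : IsClosed (torusU (starRingEnd ℂ) J : Set ↥(unitaryGroupOfForm (starRingEnd ℂ) J)) := isClosed_torusU_two _ _
  haveI : LocallyCompactSpace ↥(torusU (starRingEnd ℂ) J) := hT.isClosedEmbedding_subtypeVal.locallyCompactSpace
  haveI : SecondCountableTopology ↥(torusU (starRingEnd ℂ) J) := TopologicalSpace.Subtype.secondCountableTopology _
  haveI : BorelSpace ↥(torusU (starRingEnd ℂ) J) := Subtype.borelSpace _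
  letI : MeasurableSpace (↥(unitaryGroupOfForm (starRingEnd ℂ) J) ⧸ torusU (starRingEnd ℂ) J) := borel _
  haveI : BorelSpace (↥(unitaryGroupOfForm (starRingEnd ℂ) J) ⧸ torusU (starRingEnd ℂ) J) := ⟨rfl⟩
  have hTinv : ∀ t : Measure ↥(torusU (starRingEnd ℂ) J), t.IsHaarMeasure → t.IsInvInvariant := fun t ht => by
    haveI := ht
    haveI : t.IsMulRightInvariant := isMulRightInvariant_of_torusU t
    exact isInvInvariant_of_isMulRightInvariant t
  obtain ⟨μ, hμinv, hμfin, hμpos⟩ := WeilQuotient.exists_smulInvariantMeasure_quotient (H := torusU (starRingEnd ℂ) J) hT hTinv ν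
  haveI := hμinv
  haveI := hμfin
  haveI := hμpos
  have hμ : μ ≠ 0 := fun h => by
    have h1 := IsOpenPosMeasure.open_pos (μ := μ) Set.univ isOpen_univ Set.univ_nonempty
    rw [h] at h1
    exact h1 rfl
  set α : Measure ↥(torusU (starRingEnd ℂ) J) := Measure.haar with hα
  obtain ⟨C, hC0, hμC⟩ := exists_measure_quotient_torusU_complex_two_eq_smul_map hJ hK hKB κ α μN μ hμ
  haveI : CompactSpace ↥K := isCompact_iff_compactSpace.1 hK
  obtain ⟨κ₀, hκ₀, h4d⟩ := exists_hasOneSidedJump_iteratedDeriv_allOrders_chart_of_eq_over L w hJ ν κ μN hK hKB ΩJ hΩJ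
  refine ⟨κ₀, hκ₀, fun f hf hfc θ F hF Λ hΛ n => ?_⟩
  -- the `•`-reading of the elliptic reader (★ p851143's token) and smoothness of `F f` off the walls
  obtain ⟨F', hF'⟩ : ∃ F' : (Matrix (Fin 2) (Fin 2) ℂ → ℂ) → ℝ → ℂ, ∀ (g : Matrix (Fin 2) (Fin 2) ℂ → ℂ) (ψ : ℝ), F' g ψ = (2 * Real.sin ψ) •
      ∫ h : ↥(unitaryGroupOfForm (starRingEnd ℂ) J), g (((h * (⟨(Matrix.GeneralLinearGroup.mkOfDetNeZero !![(1 : ℂ), 1; 1, -1] det_cayleyTwo_ne_zero) * circleDiagonal 2 ![Circle.exp θ * Circle.exp ψ, Circle.exp θ * Circle.exp (-ψ)] * ((Matrix.GeneralLinearGroup.mkOfDetNeZero !![(1 : ℂ), 1; 1, -1] det_cayleyTwo_ne_zero))⁻¹,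
            cayley_conj_circleDiagonal_mem_of_eq_over hJ _⟩ : ↥(unitaryGroupOfForm (starRingEnd ℂ) J)) * h⁻¹ : ↥(unitaryGroupOfForm (starRingEnd ℂ) J)) : GL (Fin 2) ℂ) : Matrix (Fin 2) (Fin 2) ℂ) ∂ν :=
    ⟨_, fun _ _ => rfl⟩
  have hFF' : F f = F' f := funext fun ψ => by
    rw [hF, hF', Complex.real_smul]
    push_cast
    ring
  have hsmooth : ContDiffOn ℝ ∞ (F f) {ψ : ℝ | Real.sin ψ ≠ 0} := by
    rw [hFF']
    have h := contDiffOn_cayley_orbitalIntegral_param hJ ν (Circle.exp θ) F' hF' (Q := ℝ) (fun (_ : ℝ) (X : Matrix (Fin 2) (Fin 2) ℂ) => f X)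
      (hf.comp contDiff_snd) ⟨tsupport f, hfc, fun _ X hX => image_eq_zero_of_notMem_tsupport hX⟩
    exact h.comp (contDiff_prodMk_right (0 : ℝ)).contDiffOn fun ψ hψ => ⟨Set.mem_univ _, hψ⟩
  -- the odd `x`-jets of `Λ f` vanish at `0`: `C • Λ f` is the (even) normalised split orbital integral off `0` (★ (A0-b), ★ FILE 4a)
  have hΛs : ContDiff ℝ ∞ (Λ f) := (iteratedDeriv_integral_prod_conj_hypBlockGL_half hJ κ μN hK ΩJ hΩJ θ Λ hΛ hf hfc 0).1
  have hFc : Continuous fun g : ↥(unitaryGroupOfForm (starRingEnd ℂ) J) => f ((g : GL (Fin 2) ℂ) : Matrix (Fin 2) (Fin 2) ℂ) :=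
    hf.continuous.comp (Units.continuous_val.comp continuous_subtype_val)
  have hG : ∀ x : ℝ, x ≠ 0 → (fun x => (C : ℝ) • Λ f x) x = |Real.exp x - Real.exp (-x)| •
      ∫ y, descConj (⟨hypBlockGL x θ, hypBlockGL_mem_of_eq_over hJ x θ⟩ : ↥(unitaryGroupOfForm (starRingEnd ℂ) J)) (torusU (starRingEnd ℂ) J)
        (LineRing.forall_mem_torusU_comm (starRingEnd ℂ) J (hypBlockGL_mem_torusU hJ x θ))
        (fun g : ↥(unitaryGroupOfForm (starRingEnd ℂ) J) => f ((g : GL (Fin 2) ℂ) : Matrix (Fin 2) (Fin 2) ℂ)) y ∂μ := fun x hx => by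
    show (C : ℝ) • Λ f x = _
    rw [hΛ]
    exact (abs_sub_smul_integral_descConj_hypBlockGL_eq_smul_integral_prod hJ κ μN μ hμC
      (fun g : ↥(unitaryGroupOfForm (starRingEnd ℂ) J) => f ((g : GL (Fin 2) ℂ) : Matrix (Fin 2) (Fin 2) ℂ)) hFc θ hx).symm
  have hodd : Odd n → ((κ₀ : ℝ) : ℂ) * Complex.I ^ n * iteratedDeriv n (Λ f) 0 = 0 := by
    rintro ⟨k, rfl⟩
    have h0 := (iteratedDeriv_odd_eq_zero_of_eqOn_abs_sub_smul_integral_descConj hJ μ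
      (fun g : ↥(unitaryGroupOfForm (starRingEnd ℂ) J) => f ((g : GL (Fin 2) ℂ) : Matrix (Fin 2) (Fin 2) ℂ)) θ hG k).2
    rw [iteratedDeriv_fun_const_smul ((contDiff_infty.1 hΛs) (2 * k + 1)).contDiffAt, smul_eq_zero] at h0
    rcases h0 with h0 | h0
    · exact absurd h0 (NNReal.coe_ne_zero.2 hC0)
    · rw [h0, mul_zero]
  -- ★ 4d and §1 on `T := {sin ψ ≠ 0}`
  have hTopen : IsOpen {ψ : ℝ | Real.sin ψ ≠ 0} := isOpen_ne_fun Real.continuous_sin continuous_const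
  have hTsymm : ∀ ψ ∈ {ψ : ℝ | Real.sin ψ ≠ 0}, -ψ ∈ {ψ : ℝ | Real.sin ψ ≠ 0} := fun ψ (hψ : Real.sin ψ ≠ 0) => by
    show Real.sin (-ψ) ≠ 0
    rwa [Real.sin_neg, neg_ne_zero]
  have hT0 : ∀ᶠ ψ in 𝓝[≠] (0 : ℝ), ψ ∈ {ψ : ℝ | Real.sin ψ ≠ 0} := by
    have h1 : ∀ᶠ ψ in 𝓝[≠] (0 : ℝ), ψ ∈ Set.Ioo (-Real.pi) Real.pi :=
      mem_nhdsWithin_of_mem_nhds (Ioo_mem_nhds (neg_lt_zero.2 Real.pi_pos) Real.pi_pos)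
    filter_upwards [h1, self_mem_nhdsWithin] with ψ hψ (hψ0 : ψ ≠ 0)
    show Real.sin ψ ≠ 0
    intro hs
    rcases lt_or_gt_of_ne hψ0 with hlt | hgt
    · exact (Real.sin_neg_of_neg_of_neg_pi_lt hlt hψ.1).ne hs
    · exact (Real.sin_pos_of_pos_of_lt_pi hgt hψ.2).ne' hs
  have h := hasOneSidedJump_iteratedDeriv_sub_comp_neg hTopen hTsymm hT0 hsmooth (h4d f hf hfc θ F hF Λ hΛ n) hodd
  have e : 2 * (((κ₀ : ℝ) : ℂ) * Complex.I ^ n * iteratedDeriv n (Λ f) 0) = ((2 * κ₀ : ℝ) : ℂ) * Complex.I ^ n * iteratedDeriv n (Λ f) 0 := by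
    push_cast
    ring
  rw [e] at h
  exact h

end UnitaryGroup

end Literature.NumberTheory.Automorphic

end
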